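import Literature.MathematicalPhysics.QuantumManyBody.WeightedResolventCorrector
import HarnessLib

/-!
# Existence of resolvent correctors on the `N`-particle torus (named fact)

Topic `Literature/MathematicalPhysics/QuantumManyBody`; sequel of `WeightedResolventCorrector.lean`
(`IsResolventCorrector L F m g χ`: `χ` is a periodic test function solving the resolvent equation
`(m - L_F) χ = g`, `L_F = Δ + 2∇(log F)·∇`, weakly on the `C¹` periodic core,
`𝓔_F(χ, φ) + m ∫ χ φ F² = ∫ g φ F²`). That file proves uniqueness (`IsResolventCorrector.unique`) and
the `H₋₁` estimates of a resolvent corrector but constructs none. This file vendors EXISTENCE, with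
the `C¹` regularity built into the notion, as a named fact — the optional part of definition item
`defn-IsResolventCorrector` (crux line `insertion-mode-gaussian-domination` of route
`BECInsertionCorrector`, whose first-order domination step needs the massive correctors
`(p² - L_{Θ₀})⁻¹` of the bath density modes to exist as periodic `C¹` weak solutions).

* `ResolventCorrectorExistence` — for `L > 0`, `m > 0`, a `C¹` lattice-periodic nowhere-vanishing
  weight `F` and a continuous lattice-periodic source `g` there is a resolvent corrector.
* Proved consequences: `existsUnique` (with `IsResolventCorrector.unique`) and
  `exists_hMinusOneSqW_le` (existence packaged with the resolvent contraction
  `‖χ‖²₋₁ ≤ m⁻² ‖g‖²₋₁` of `IsResolventCorrector.hMinusOneSqW_le`).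

## The proof in print (linear elliptic theory; why this is a fact and not a theorem here)

Write `𝕋 = (ℝ³/Lℤ³)^N` for the flat torus, `d = 3N`.
1. *Weak solution.* On the Sobolev space `H¹(𝕋)` the bilinear form
   `B(u, v) = ∫_𝕋 (∇u·∇v + m u v) F² dX` is bounded and coercive — `F` is continuous, periodic and
   nowhere zero, so `0 < min F² ≤ F² ≤ max F²` on the compact torus, and `m > 0` — and
   `v ↦ ∫_𝕋 g v F²` is a bounded functional; the Lax–Milgram lemma [GilbargTrudinger2001, Thm 5.8]
   gives `u ∈ H¹(𝕋)` with `B(u, v) = ∫_𝕋 g v F²` for every `v ∈ H¹(𝕋)`.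
2. *Regularity.* The periodic lift of `u` to `ℝ^d` is, on every ball `Ω`, a `W^{1,2}(Ω)` weak
   solution of the divergence-form equation `D_i(F² D_i u) - m F² u = -g F²`, i.e. of
   [GilbargTrudinger2001, (8.3)/(8.83)] with `a^{ij} = F² δ^{ij} ∈ C^{0,1}(Ω̄) ⊆ C^α(Ω̄)`,
   `bⁱ = cⁱ = 0`, `d = -m F² ∈ L^∞(Ω)`, `fⁱ = 0` and right side `-g F² ∈ L^∞(Ω)`, strictly elliptic
   with `λ = min F² > 0` (a compactly supported test function on `Ω` is periodised into a test
   function on `𝕋`). By the interior `C^{1,α}` regularity of `W^{1,2}` weak solutions of such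
   equations [GilbargTrudinger2001, Cor. 8.36 with `T = ∅`], `u ∈ C^{1,α}(Ω)` for every ball, so the
   lift is `C¹` on `(ℝ³)^N` and lattice periodic: a periodic test function (`IsPeriodicTest`).
3. *The cell equation.* A `C¹` lattice-periodic `φ` defines an element of `H¹(𝕋)`, and integrals
   over `𝕋` are integrals over the fundamental cell `[0,L)^{3N}`; so step 1 tested against `φ` is
   `𝓔_F(u, φ) + m ∫_{cell} u φ F² = ∫_{cell} g φ F²`, the defining identity of `IsResolventCorrector`.

Mathlib has the Lax–Milgram lemma (`IsCoercive.continuousLinearEquivOfBilin`) but neither Sobolev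
spaces of the torus nor elliptic (`C^{1,α}` / `W^{2,p}`) regularity, which is the substance of
step 2; hence a named fact. Hypotheses are those the proof uses: `F ∈ C¹` (for `F² ∈ C^α`;
with a merely continuous weight weak solutions need not be `C¹` and the statement would be
false for the `C¹` core), `F ≠ 0` everywhere, `g` continuous (for `g F² ∈ L^∞`), `m > 0`
(coercivity; the centred case `m = 0` is not stated), `L > 0`.

## References

* [GilbargTrudinger2001] D. Gilbarg, N. S. Trudinger, *Elliptic Partial Differential Equations of
  Second Order*, Classics in Mathematics, Springer 2001: Thm 5.8 (Lax–Milgram), §8.1 (8.3),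
  §8.11 (8.83) and Cor. 8.36 (interior `C^{1,α}` regularity of weak solutions, `T = ∅`).
* [KipnisLandim1999] C. Kipnis, C. Landim, *Scaling Limits of Interacting Particle Systems*,
  Springer 1999: App. 1 §6, proof of Prop. 6.1 (the resolvent equation; there `L` is bounded and
  existence is immediate).
-/

noncomputable section

open MeasureTheory
open scoped ENNReal NNReal

namespace Literature.MathematicalPhysics.QuantumManyBody.BoseGas

variable {N : ℕ} {L m : ℝ} {F g : Config N → ℝ}

/-- **Existence of resolvent correctors on the torus.** For `L > 0`, `m > 0`, a weight
`F : (ℝ³)^N → ℝ` of class `C¹`, `Lℤ³`-periodic in every particle and nowhere zero, and a continuous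
lattice-periodic source `g`, the resolvent equation `(m - L_F) χ = g` has a weak solution on the
`C¹` periodic core, i.e. a resolvent corrector `χ` (`IsResolventCorrector L F m g χ`: `χ` is `C¹`,
lattice periodic, and `𝓔_F(χ, φ) + m ∫ χ φ F² = ∫ g φ F²` for every periodic test function `φ`);
it is unique (`existsUnique`). In print: the form `∫ (∇u·∇v + m u v) F²` is bounded and coercive on
the Sobolev space `H¹` of the flat torus (`0 < min F² ≤ F² ≤ max F²`, `m > 0`), so the Lax–Milgram
lemma [Thm 5.8] yields a weak solution `u ∈ H¹`; its periodic lift is on every ball of `ℝ^{3N}` a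
`W^{1,2}` weak solution of the divergence-form equation `D_i(F² D_i u) - m F² u = -g F²`
((8.3)/(8.83) with `a^{ij} = F² δ^{ij} ∈ C^{0,1} ⊆ C^α`, `d = -m F²`, right side in `L^∞`,
`λ = min F²`), hence `C^{1,α}` by the interior regularity of weak solutions [Cor. 8.36, `T = ∅`],
so the lift is a periodic test function, and integrals over the torus are integrals over the
fundamental cell. (The case `m = 0` — correctors of centred sources — is not stated.)
[cite: GilbargTrudinger2001, Thm 5.8 and Cor 8.36] -/
def ResolventCorrectorExistence : Prop :=
  ∀ (N : ℕ) (L m : ℝ), 0 < L → 0 < m →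
    ∀ F : Config N → ℝ, IsPeriodicTest L F → (∀ X, F X ≠ 0) →
      ∀ g : Config N → ℝ, Continuous g → IsLatticePeriodic L g →
        ∃ χ : Config N → ℝ, IsResolventCorrector L F m g χ

namespace ResolventCorrectorExistence

/-- **Existence and uniqueness** of the resolvent corrector (existence: the fact; uniqueness:
`IsResolventCorrector.unique`). [cite: GilbargTrudinger2001, Thm 5.8 and Cor 8.36] -/
theorem existsUnique (h : ResolventCorrectorExistence) (hL : 0 < L) (hm : 0 < m)
    (hF : IsPeriodicTest L F) (h0 : ∀ X, F X ≠ 0) (hg : Continuous g)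
    (hgper : IsLatticePeriodic L g) : ∃! χ : Config N → ℝ, IsResolventCorrector L F m g χ := by
  obtain ⟨χ, hχ⟩ := h N L m hL hm F hF h0 g hg hgper
  exact ⟨χ, hχ, fun χ' hχ' => hχ'.unique hL hF.continuous h0 hm hχ⟩

/-- Existence packaged with the **resolvent contraction** `‖χ‖²₋₁ ≤ m⁻² ‖g‖²₋₁`
(`IsResolventCorrector.hMinusOneSqW_le`): the corrector exists and inherits the `H₋₁` bound of its
source divided by `m²` — the shape consumed by first-order domination bounds.
[cite: KipnisLandim1999, App. 1 §6, (6.3)] -/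
theorem exists_hMinusOneSqW_le (h : ResolventCorrectorExistence) (hL : 0 < L) (hm : 0 < m)
    (hF : IsPeriodicTest L F) (h0 : ∀ X, F X ≠ 0) (hg : Continuous g)
    (hgper : IsLatticePeriodic L g) :
    ∃ χ : Config N → ℝ, IsResolventCorrector L F m g χ ∧
      hMinusOneSqW L F χ ≤ ENNReal.ofReal (m⁻¹ ^ 2) * hMinusOneSqW L F g := by
  obtain ⟨χ, hχ⟩ := h N L m hL hm F hF h0 g hg hgper
  exact ⟨χ, hχ, hχ.hMinusOneSqW_le hF.continuous hm⟩

end ResolventCorrectorExistence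

end Literature.MathematicalPhysics.QuantumManyBody.BoseGas
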